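import Summits.CriticalPhenomena.PercolationContinuityZ3.Theorems.Transplant.SkelPhiEquilibriumWidth
import Summits.CriticalPhenomena.PercolationContinuityZ3.Theorems.Transplant.TwoAxisDrift
import HarnessLib

/-!
# N1 (the {±1} node), LEVEL 0, file (L0-3c, part 1): the CORE of Martineau–Tassion's Lemma 3.5 — the abstract split lemma (their Lemma 3.3 for any finite monotone
# chain of targets), the equilibrium height `ℓ_eq(n,h)` (`= max{ℓ ≥ ℓ_B : P(SEED ↔ UD) ≥ P(SEED ↔ LR)}`, finite by Fact 2, `≥ ℓ_B` by Fact 1, downward closed by the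
# monotonicity of the two events) and its two certificates ((17): below the equilibrium the LAYERS are likely, above it the SIDES are), and the central-inversion symmetry
# of the Set-level side / layer pieces (each directed side resp. each of the top/bottom layers carries the square root of the pair's bound)

builds on p205010 (kernel theorem, internal audit signed; external expert review pending) — nothing in this file uses p205010; nothing is claimed about the
open node `SamePDropOfSkeletonNeg`.  Lane `prim-bschramm`, seat `prim-bschramm-p3` (gen 8; design owner); helper file (`--supports stmt-CriticalPhenomena-4575`);
NEG-SCOPE.md §3 (L0-3).
[cite: MartineauTassion2017, §3.2 Lemma 3.3, Lemma 3.5 ((17)–(19))] [cite: GrimmettPercolation1999, §11 (11.14) (square-root trick)]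
-/

noncomputable section

namespace Summit.CriticalPhenomena.PercolationContinuityZ3.Theorems.Transplant

namespace Skelφ

namespace Eq

open MeasureTheory ProbabilityTheory Filter Topology Literature.Probability.Percolation Literature.Probability.LatticeModels SimpleGraph KNLevels
open scoped Classical

variable {V : Type} {G : SimpleGraph V}

/-! ## §1 The abstract split lemma (Martineau–Tassion's Lemma 3.3) -/

/-- **Split lemma.** Let `A 0 ⊇ A 1 ⊇ …` be increasing events with `A m` of probability `< 1 − √ε`… — abstractly: increasing measurable events `A i`, `B i` (`i ≤ m`) with
`A 0 ⊆ A (i+1) ∪ B i` for `i < m`, `P(A 0) ≥ 1 − ε` and `P(A m) < 1 − √ε`.  Then some index `i < m` has BOTH `P(A i) ≥ 1 − √ε` and `P(B i) ≥ 1 − √ε` (take the last `i` with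
`P(A i) ≥ 1 − √ε`; Harris on `A (i+1) ∪ B i`). [cite: MartineauTassion2017, §3.2 Lemma 3.3] -/
theorem exists_split [Countable V] (p : unitInterval) {m : ℕ} (A B : ℕ → Set (BondConfig V)) (hAu : ∀ i, IsUpperSet (A i)) (hBu : ∀ i, IsUpperSet (B i))
    (hAm : ∀ i, MeasurableSet (A i)) (hBm : ∀ i, MeasurableSet (B i)) (hcover : ∀ i < m, A 0 ⊆ A (i + 1) ∪ B i) {ε : ℝ} (hε0 : 0 ≤ ε)
    (h0 : 1 - ε ≤ (bondPercolation G p).real (A 0)) (hm : (bondPercolation G p).real (A m) < 1 - Real.sqrt ε) :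
    ∃ i < m, 1 - Real.sqrt ε ≤ (bondPercolation G p).real (A i) ∧ 1 - Real.sqrt ε ≤ (bondPercolation G p).real (B i) := by
  set μ := bondPercolation G p with hμ
  have hεsq : ε ≤ Real.sqrt ε := by
    by_cases h1 : ε ≤ 1
    · calc ε = Real.sqrt ε * Real.sqrt ε := (Real.mul_self_sqrt hε0).symm
        _ ≤ Real.sqrt ε * 1 := by gcongr; rw [Real.sqrt_le_one]; exact h1
        _ = Real.sqrt ε := mul_one _
    · have : (1 : ℝ) ≤ Real.sqrt ε := by rw [Real.le_sqrt (by norm_num) hε0]; linarith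
      have h2 : μ.real (A m) < 0 := by linarith
      exact absurd h2 (not_lt.2 measureReal_nonneg)
  -- the qualifying indices
  set H : Finset ℕ := (Finset.range m).filter fun i => 1 - Real.sqrt ε ≤ μ.real (A i) with hH
  have hm0 : 0 < m := by
    by_contra hz
    have : m = 0 := by omega
    subst this
    linarith
  have h0H : 0 ∈ H := by rw [hH, Finset.mem_filter, Finset.mem_range]; exact ⟨hm0, by linarith⟩
  have hne : H.Nonempty := ⟨0, h0H⟩
  set i := H.max' hne with hi
  have hiH : i ∈ H := Finset.max'_mem H hne
  have hiH' := hiH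
  rw [hH, Finset.mem_filter, Finset.mem_range] at hiH'
  obtain ⟨him, hAi⟩ := hiH'
  refine ⟨i, him, hAi, ?_⟩
  -- `i + 1` does not qualify
  have hnot : μ.real (A (i + 1)) < 1 - Real.sqrt ε := by
    by_cases hlast : i + 1 = m
    · rw [hlast]; exact hm
    · by_contra hge
      have hin : i + 1 ∈ H := by
        rw [hH, Finset.mem_filter, Finset.mem_range]; exact ⟨by omega, not_lt.1 hge⟩
      have := H.le_max' _ hin
      rw [← hi] at this
      omega
  have hmax := TwoAxis.sqrt_trick_max G p (hAu (i + 1)) (hBu i) (hAm (i + 1)) (hBm i)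
  have hcov : μ.real (A 0) ≤ μ.real (A (i + 1) ∪ B i) := measureReal_mono (hcover i him)
  have hle : 1 - Real.sqrt ε ≤ 1 - Real.sqrt (1 - μ.real (A (i + 1) ∪ B i)) := by
    have h1 : 1 - μ.real (A (i + 1) ∪ B i) ≤ ε := by linarith
    have := Real.sqrt_le_sqrt h1
    linarith
  rcases le_max_iff.1 (hle.trans hmax) with h1 | h2
  · exact absurd h1 (not_le.2 hnot)
  · exact h2

/-! ## §2 The equilibrium height -/

variable {φ : V → Site 2} {t : V}

/-- `good n h ℓ`: at height `ℓ` the layers are at least as likely as the sides. [cite: MartineauTassion2017, §3.2 (ℓ_eq)] -/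
def Good (G : SimpleGraph V) (φ : V → Site 2) (t : V) (p : unitInterval) (SEED : Set V) (n : ℕ) (h : ℤ) (ℓ : ℕ) : Prop :=
  (bondPercolation G p).real (evLR φ t SEED n h ℓ) ≤ (bondPercolation G p).real (evUD φ t SEED n h ℓ)

/-- **`Good` is downward closed in the height** above the seed (sides ↑, layers ↓ in `ℓ`). [cite: MartineauTassion2017, §3.2 (the alternative (17))] -/
theorem good_of_le [Countable V] (hlip : Lip G φ) (p : unitInterval) {SEED : Set V} {n : ℕ} {h : ℤ} {ℓ₀ ℓ ℓ' : ℕ} (hS : SEED ⊆ pgramCyl φ t n h ℓ₀) (h₀ : ℓ₀ ≤ ℓ)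
    (hℓ : ℓ ≤ ℓ') (hg : Good G φ t p SEED n h ℓ') : Good G φ t p SEED n h ℓ := by
  unfold Good at hg ⊢
  have h1 : (bondPercolation G p).real (evLR φ t SEED n h ℓ) ≤ (bondPercolation G p).real (evLR φ t SEED n h ℓ') := measureReal_mono (evLR_mono_height φ t SEED n h hℓ)
  have h2 : (bondPercolation G p).real (evUD φ t SEED n h ℓ') ≤ (bondPercolation G p).real (evUD φ t SEED n h ℓ) := by
    rw [measureReal_def, measureReal_def]
    refine ENNReal.toReal_mono (measure_ne_top _ _) (measure_mono_ae ?_)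
    filter_upwards [(setBernoulli_ae_subset : ∀ᵐ ω ∂bondPercolation G p, ω ⊆ G.edgeSet)] with ω hω hU
    exact evUD_anti_height φ t hlip hℓ (hS.trans (pgramCyl_mono t n h h₀)) hω hU
  linarith

/-- **The equilibrium height** `ℓ_eq`: the largest `ℓ` in `[ℓ_B, L]` with `Good` (`L` a height bound from Fact 2), when `Good` holds at `ℓ_B` (Fact 1); as a definition, the `max'` of the
qualifying heights with a default. [cite: MartineauTassion2017, §3.2 (ℓ_eq(h))] -/
def ℓeq (G : SimpleGraph V) (φ : V → Site 2) (t : V) (p : unitInterval) (SEED : Set V) (n : ℕ) (h : ℤ) (ℓb L : ℕ) : ℕ :=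
  if hne : ((Finset.Icc ℓb L).filter fun ℓ => Good G φ t p SEED n h ℓ).Nonempty then ((Finset.Icc ℓb L).filter fun ℓ => Good G φ t p SEED n h ℓ).max' hne else ℓb

/-- `ℓ_eq` qualifies when `Good` holds at `ℓ_B ≤ L`: `ℓ_B ≤ ℓ_eq ≤ L` and `Good` at `ℓ_eq`. [folklore] -/
theorem ℓeq_spec (p : unitInterval) {SEED : Set V} {n : ℕ} {h : ℤ} {ℓb L : ℕ} (hbL : ℓb ≤ L) (hgood : Good G φ t p SEED n h ℓb) :
    ℓb ≤ ℓeq G φ t p SEED n h ℓb L ∧ ℓeq G φ t p SEED n h ℓb L ≤ L ∧ Good G φ t p SEED n h (ℓeq G φ t p SEED n h ℓb L) := by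
  have hmem : ℓb ∈ (Finset.Icc ℓb L).filter fun ℓ => Good G φ t p SEED n h ℓ := by
    rw [Finset.mem_filter, Finset.mem_Icc]; exact ⟨⟨le_rfl, hbL⟩, hgood⟩
  have hne : ((Finset.Icc ℓb L).filter fun ℓ => Good G φ t p SEED n h ℓ).Nonempty := ⟨ℓb, hmem⟩
  have hdef : ℓeq G φ t p SEED n h ℓb L = ((Finset.Icc ℓb L).filter fun ℓ => Good G φ t p SEED n h ℓ).max' hne := by
    unfold ℓeq; rw [dif_pos hne]
  have hmax := Finset.max'_mem _ hne
  rw [← hdef, Finset.mem_filter, Finset.mem_Icc] at hmax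
  exact ⟨hmax.1.1, hmax.1.2, hmax.2⟩

/-- Above `ℓ_eq` (up to `L`) `Good` fails. [folklore] -/
theorem not_good_of_ℓeq_lt (p : unitInterval) {SEED : Set V} {n : ℕ} {h : ℤ} {ℓb L ℓ : ℕ} (hbL : ℓb ≤ L) (hgood : Good G φ t p SEED n h ℓb)
    (hlt : ℓeq G φ t p SEED n h ℓb L < ℓ) (hℓL : ℓ ≤ L) : ¬ Good G φ t p SEED n h ℓ := by
  intro hg
  have hmem : ℓ ∈ (Finset.Icc ℓb L).filter fun ℓ => Good G φ t p SEED n h ℓ := by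
    rw [Finset.mem_filter, Finset.mem_Icc]; exact ⟨⟨(ℓeq_spec p hbL hgood).1.trans hlt.le, hℓL⟩, hg⟩
  have hne : ((Finset.Icc ℓb L).filter fun ℓ => Good G φ t p SEED n h ℓ).Nonempty := ⟨ℓ, hmem⟩
  have hle := Finset.le_max' _ _ hmem
  have hdef : ℓeq G φ t p SEED n h ℓb L = ((Finset.Icc ℓb L).filter fun ℓ => Good G φ t p SEED n h ℓ).max' hne := by
    unfold ℓeq; rw [dif_pos hne]
  rw [← hdef] at hle
  omega

/-! ## §3 The two certificates at / above the equilibrium (eq. (17)) -/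

/-- **Below the equilibrium the layers are likely**: `Good` at `ℓ` and `P(LR ∪ UD) ≥ 1 − ε` give `P(SEED ↔ UD in C) ≥ 1 − √ε`. [cite: MartineauTassion2017, §3.2 (17)] -/
theorem real_evUD_ge_of_good [Countable V] (p : unitInterval) {SEED : Set V} {n : ℕ} {h : ℤ} {ℓ : ℕ} {ε : ℝ} (hg : Good G φ t p SEED n h ℓ)
    (h12 : 1 - ε ≤ (bondPercolation G p).real (evLR φ t SEED n h ℓ ∪ evUD φ t SEED n h ℓ)) :
    1 - Real.sqrt ε ≤ (bondPercolation G p).real (evUD φ t SEED n h ℓ) := by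
  have hmax := TwoAxis.sqrt_trick_max G p (isUpperSet_evLR φ t SEED n h ℓ) (isUpperSet_evUD φ t SEED n h ℓ)
    (IsoradialArmExtension.measurableSet_openCrossing' _ _ _) (IsoradialArmExtension.measurableSet_openCrossing' _ _ _)
  have hle : 1 - Real.sqrt ε ≤ 1 - Real.sqrt (1 - (bondPercolation G p).real (evLR φ t SEED n h ℓ ∪ evUD φ t SEED n h ℓ)) := by
    have := Real.sqrt_le_sqrt (show 1 - (bondPercolation G p).real (evLR φ t SEED n h ℓ ∪ evUD φ t SEED n h ℓ) ≤ ε by linarith)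
    linarith
  have := hle.trans hmax
  rw [max_eq_right hg] at this
  exact this

/-- **Above the equilibrium the sides are likely**: `¬ Good` at `ℓ` and `P(LR ∪ UD) ≥ 1 − ε` give `P(SEED ↔ LR in C) ≥ 1 − √ε`. [cite: MartineauTassion2017, §3.2 (17)] -/
theorem real_evLR_ge_of_not_good [Countable V] (p : unitInterval) {SEED : Set V} {n : ℕ} {h : ℤ} {ℓ : ℕ} {ε : ℝ} (hg : ¬ Good G φ t p SEED n h ℓ)
    (h12 : 1 - ε ≤ (bondPercolation G p).real (evLR φ t SEED n h ℓ ∪ evUD φ t SEED n h ℓ)) :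
    1 - Real.sqrt ε ≤ (bondPercolation G p).real (evLR φ t SEED n h ℓ) := by
  have hmax := TwoAxis.sqrt_trick_max G p (isUpperSet_evLR φ t SEED n h ℓ) (isUpperSet_evUD φ t SEED n h ℓ)
    (IsoradialArmExtension.measurableSet_openCrossing' _ _ _) (IsoradialArmExtension.measurableSet_openCrossing' _ _ _)
  have hle : 1 - Real.sqrt ε ≤ 1 - Real.sqrt (1 - (bondPercolation G p).real (evLR φ t SEED n h ℓ ∪ evUD φ t SEED n h ℓ)) := by
    have := Real.sqrt_le_sqrt (show 1 - (bondPercolation G p).real (evLR φ t SEED n h ℓ ∪ evUD φ t SEED n h ℓ) ≤ ε by linarith)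
    linarith
  have := hle.trans hmax
  unfold Good at hg
  rw [max_eq_left (le_of_lt (not_le.1 hg))] at this
  exact this

end Eq

end Skelφ

end Summit.CriticalPhenomena.PercolationContinuityZ3.Theorems.Transplant

end
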